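import Literature.Barriers.Parity.SiegelZeroPrimePairs
import Literature.NumberTheory.LFunctions.SiegelExceptionalZeroBound
import HarnessLib

/-!
# Matomäki–Merikoski Corollary 1.1(ii) from Theorem 1.3: the printed deduction, proved

Sibling of `Literature/Barriers/Parity/SiegelZeroPrimePairs.lean`, which vendors
Matomäki–Merikoski, *Siegel zeros, twin primes, Goldbach's conjecture, and primes in short
intervals* (IMRN 2023; arXiv:2112.11412), Theorem 1.3 as the named fact
`Literature.Barriers.Parity.MatomakiMerikoski2023_pairCorrelation` and Corollary 1.1(ii) as the named fact
`Literature.Barriers.Parity.MatomakiMerikoski2023_fixedShift_ii`. The source proves the corollary in three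
lines (p. 4, after Theorem 1.4): "Corollaries 1.1(i) and 1.2 immediately follow from Theorems 1.3
and 1.4 since by Siegel's theorem (see e.g. [MV]) `η ≪_ε q^ε`. For `X ≥ q^{10 log η}` the quantity
`1/η = exp(−log η) ≫ exp(−√((log q)(log η))) ≫ exp(−√(log X))` dominates
`exp(−C(log X)^{3/5−ε})` and `exp(−CV√(log η))`, so also Corollary 1.1(ii) follows from
Theorem 1.3." This file formalises exactly that deduction:

* `Literature.Barriers.Parity.MatomakiMerikoski2023_fixedShift_ii_of_pairCorrelation` —
  `MatomakiMerikoski2023_pairCorrelation → MatomakiMerikoski2023_fixedShift_ii` (**proved**).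
  Theorem 1.3 is used with `C = 1`, `ε = 1/10` (exponent `3/5 − 1/10 = 1/2`) and `h = O(X)`
  constant `A = h`; Siegel's theorem is the tree's PROVED
  `Literature.NumberTheory.LFunctions.Siegel.exists_one_sub_realZero_ge` (Montgomery–Vaughan Cor. 11.15) with exponent `1/4`,
  giving `η ≤ D q^{1/4}`, `D = 1/(C(1/4) log 2)`, whence `exp(−√(V log q)) ≤ (1 + D²)/η`
  (cases `q ≥ η` / `q < η`), `exp(−√(V log η)) ≤ 1/η`, and `1/η ≤ log⁶η · V/η`.
* The correction factor `1_{φ(2^r) ∣ h} (−1)^{h/φ(2^r)} ∏_{p ∣ q', p ∤ h} (−1)/(p − 2)` of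
  Theorem 1.3 (absent from the corollary, absorbed in `O_h`) is bounded by `√(24h/q) ≤ √(24h)D²/η`
  (`Literature.Barriers.Parity.SiegelCorr.abs_corr_le`): for a PRIMITIVE quadratic character mod `q = 2^r q'`
  the odd part `q'` is squarefree ("note that `q'` is necessarily square-free", loc. cit.) and
  `r ≤ 3`, proved here from Mathlib's `DirichletCharacter.factorsThrough_iff_ker_unitsMap`
  (`SiegelCorr.factorsThrough_div_of_odd_prime_sq_dvd`,
  `SiegelCorr.factorsThrough_div_two_of_sixteen_dvd`: the kernel of `(ℤ/q)ˣ → (ℤ/(q/p))ˣ`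
  consists of `p`-th roots of unity when `p² ∣ q`, `p` odd, and of squares when `p = 2`,
  `16 ∣ q`), so `q ≤ 8q' ≤ 8h ∏_{p ∣ q', p ∤ h} p ≤ 24h (∏ (p − 2))²`.

The unconditional `MatomakiMerikoski2023_fixedShift_ii_holds` would in addition need Theorem 1.3
itself (§§2–7 of the source: `β`-sieve, Henriot's bound, exceptional-character sums with a
Vinogradov–Korobov error term), which the tree holds only as a named fact.

## References

* K. Matomäki, J. Merikoski, *Siegel zeros, twin primes, Goldbach's conjecture, and primes in
  short intervals*, IMRN 2023:23, 20337–20384 (arXiv:2112.11412): Corollary 1.1, Theorem 1.3 and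
  the deduction printed after Theorem 1.4 (arXiv p. 4).
  [cite: MatomakiMerikoski2023, Corollary 1.1(ii)]
* H. L. Montgomery, R. C. Vaughan, *Multiplicative Number Theory I*, Cambridge 2007, Cor. 11.15
  (Siegel's theorem for real zeros; tree: `Literature.NumberTheory.LFunctions.Siegel.exists_one_sub_realZero_ge`).
  [cite: MontgomeryVaughan2007, Corollary 11.15]
-/

noncomputable section

open DirichletCharacter

/-! ### The conductor of a primitive quadratic character, and the size of the correction factor -/

namespace Literature.Barriers.Parity.SiegelCorr

/-- `(1 + x)^n = 1 + n x` when `x² = 0`. [folklore] -/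
theorem one_add_pow_of_mul_self_eq_zero {R : Type*} [CommRing R] {x : R} (hx : x * x = 0) (n : ℕ) :
    (1 + x) ^ n = 1 + n * x := by
  induction n with
  | zero => simp
  | succ n ih =>
    rw [pow_succ, ih]
    push_cast
    linear_combination (n : R) * hx

variable {q : ℕ} [NeZero q]

/-- An element of the kernel of `(ℤ/q)ˣ → (ℤ/d)ˣ` (`d ∣ q`) is of the form `1 + t d` in `ℤ/q`.
[folklore] -/
theorem exists_eq_one_add_mul_of_mem_ker {d : ℕ} (hd : d ∣ q) {u : (ZMod q)ˣ}
    (hu : u ∈ (ZMod.unitsMap hd).ker) : ∃ t : ZMod q, (u : ZMod q) = 1 + t * d := by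
  rw [MonoidHom.mem_ker, Units.ext_iff, ZMod.unitsMap_val, ← ZMod.natCast_val, Units.val_one,
    ← Nat.cast_one, ZMod.natCast_eq_natCast_iff] at hu
  obtain ⟨k, hk⟩ := Nat.modEq_iff_dvd.mp hu
  refine ⟨-(k : ZMod q), ?_⟩
  have h1 : (u : ZMod q) = (((u : ZMod q).val : ℤ) : ZMod q) := by
    rw [Int.cast_natCast, ZMod.natCast_zmod_val]
  have h2 : (((u : ZMod q).val : ℤ) : ZMod q) = (((1 : ℕ) : ℤ) - (d : ℤ) * k : ℤ) := by
    rw [← hk]; push_cast; ring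
  rw [h1, h2]; push_cast; ring

variable {R : Type*} [CommRing R]

/-- A quadratic character mod `q` factors through `q / p` when `p` is an odd prime with `p² ∣ q`:
the kernel of `(ℤ/q)ˣ → (ℤ/(q/p))ˣ` consists of the `u = 1 + x`, `x = t q/p`, with `x² = 0` and
`p x = 0` in `ℤ/q`, so `u^p = 1 + p x = 1` and `χ(u) = χ(u)^p = 1` (`p` odd, `χ(u)² = 1`).
[folklore] -/
theorem factorsThrough_div_of_odd_prime_sq_dvd (χ : DirichletCharacter R q) (hχ : χ.IsQuadratic)
    {p : ℕ} (hp : p.Prime) (hp2 : p ≠ 2) (hpq : p ^ 2 ∣ q) : χ.FactorsThrough (q / p) := by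
  have hpq1 : p ∣ q := (dvd_pow_self p two_ne_zero).trans hpq
  have hd : q / p ∣ q := Nat.div_dvd_of_dvd hpq1
  rw [factorsThrough_iff_ker_unitsMap hd]
  intro u hu
  obtain ⟨t, ht⟩ := exists_eq_one_add_mul_of_mem_ker hd hu
  have hpm : p ∣ q / p := by
    have h2 : p * p ∣ p * (q / p) := by rw [Nat.mul_div_cancel' hpq1, ← pow_two]; exact hpq
    exact Nat.dvd_of_mul_dvd_mul_left hp.pos h2
  set x : ZMod q := t * ((q / p : ℕ) : ZMod q) with hxdef
  have hxx : x * x = 0 := by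
    have hnat : (q / p) * (q / p) = q * (q / p / p) := by
      calc (q / p) * (q / p) = (q / p) * (p * (q / p / p)) := by rw [Nat.mul_div_cancel' hpm]
        _ = (q / p * p) * (q / p / p) := by ring
        _ = q * (q / p / p) := by rw [Nat.div_mul_cancel hpq1]
    have hcast : ((q / p : ℕ) : ZMod q) * ((q / p : ℕ) : ZMod q) = 0 := by
      rw [← Nat.cast_mul, hnat, Nat.cast_mul, ZMod.natCast_self, zero_mul]
    calc x * x = t * t * (((q / p : ℕ) : ZMod q) * ((q / p : ℕ) : ZMod q)) := by rw [hxdef]; ring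
      _ = 0 := by rw [hcast, mul_zero]
  have hpx : (p : ZMod q) * x = 0 := by
    have h0 : ((p * (q / p) : ℕ) : ZMod q) = 0 := by
      rw [Nat.mul_div_cancel' hpq1, ZMod.natCast_self]
    calc (p : ZMod q) * x = t * ((p * (q / p) : ℕ) : ZMod q) := by rw [hxdef]; push_cast; ring
      _ = 0 := by rw [h0, mul_zero]
  have hup : (u : ZMod q) ^ p = 1 := by
    rw [ht, one_add_pow_of_mul_self_eq_zero hxx, hpx, add_zero]
  have h1 : χ u ^ p = 1 := by rw [← map_pow, hup, map_one]
  have h2 : χ u ^ 2 = 1 := by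
    rw [← MulChar.pow_apply_coe, hχ.sq_eq_one, MulChar.one_apply_coe]
  obtain ⟨k, hk⟩ := hp.odd_of_ne_two hp2
  have h3 : χ u = 1 := by
    calc χ u = (χ u ^ 2) ^ k * χ u := by rw [h2, one_pow, one_mul]
      _ = χ u ^ p := by rw [hk]; ring
      _ = 1 := h1
  rw [MonoidHom.mem_ker, Units.ext_iff, MulChar.coe_toUnitHom, Units.val_one]
  exact h3

/-- A quadratic character mod `q` factors through `q / 2` when `16 ∣ q`: the kernel of
`(ℤ/q)ˣ → (ℤ/(q/2))ˣ` consists of the `u = 1 + t q/2 = (1 + y)²`, `y = t q/4` (`y² = 0` in `ℤ/q`),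
so `χ(u) = χ(1 + y)² = 1`. [folklore] -/
theorem factorsThrough_div_two_of_sixteen_dvd (χ : DirichletCharacter R q) (hχ : χ.IsQuadratic)
    (h16 : 16 ∣ q) : χ.FactorsThrough (q / 2) := by
  have h2q : 2 ∣ q := (by norm_num : (2 : ℕ) ∣ 16).trans h16
  have h4q : 4 ∣ q := (by norm_num : (4 : ℕ) ∣ 16).trans h16
  have hd : q / 2 ∣ q := Nat.div_dvd_of_dvd h2q
  rw [factorsThrough_iff_ker_unitsMap hd]
  intro u hu
  obtain ⟨t, ht⟩ := exists_eq_one_add_mul_of_mem_ker hd hu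
  have h24 : 2 * (q / 4) = q / 2 := by
    conv_rhs => rw [← Nat.mul_div_cancel' h4q]
    rw [show 4 * (q / 4) = 2 * (2 * (q / 4)) by ring, Nat.mul_div_cancel_left _ two_pos]
  have h44 : 4 ∣ q / 4 := by
    have : (4 * 4 : ℕ) ∣ 4 * (q / 4) := by rw [Nat.mul_div_cancel' h4q]; exact h16
    exact Nat.dvd_of_mul_dvd_mul_left (by norm_num) this
  set y : ZMod q := t * ((q / 4 : ℕ) : ZMod q) with hydef
  have hyy : y * y = 0 := by
    have hnat : (q / 4) * (q / 4) = q * (q / 4 / 4) := by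
      calc (q / 4) * (q / 4) = (q / 4) * (4 * (q / 4 / 4)) := by rw [Nat.mul_div_cancel' h44]
        _ = (q / 4 * 4) * (q / 4 / 4) := by ring
        _ = q * (q / 4 / 4) := by rw [Nat.div_mul_cancel h4q]
    have hcast : ((q / 4 : ℕ) : ZMod q) * ((q / 4 : ℕ) : ZMod q) = 0 := by
      rw [← Nat.cast_mul, hnat, Nat.cast_mul, ZMod.natCast_self, zero_mul]
    calc y * y = t * t * (((q / 4 : ℕ) : ZMod q) * ((q / 4 : ℕ) : ZMod q)) := by rw [hydef]; ring
      _ = 0 := by rw [hcast, mul_zero]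
  have h2y : 2 * y = t * ((q / 2 : ℕ) : ZMod q) := by
    rw [← h24, hydef]; push_cast; ring
  have hv : (1 + y) * (1 - y) = 1 := by linear_combination (-1 : ZMod q) * hyy
  set v : (ZMod q)ˣ := ⟨1 + y, 1 - y, hv, by rw [mul_comm]; exact hv⟩ with hvdef
  have huv : (u : ZMod q) = (v : ZMod q) ^ 2 := by
    rw [ht, ← h2y]
    show 1 + 2 * y = (1 + y) ^ 2
    linear_combination (-1 : ZMod q) * hyy
  rw [MonoidHom.mem_ker, Units.ext_iff, MulChar.coe_toUnitHom, Units.val_one, huv, map_pow,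
    ← MulChar.pow_apply_coe, hχ.sq_eq_one, MulChar.one_apply_coe]

/-- If `χ` factors through a proper divisor level `d < q`, then `χ` is not primitive. [folklore] -/
theorem not_isPrimitive_of_factorsThrough (χ : DirichletCharacter R q) {d : ℕ} (hd : d ∣ q)
    (hdq : d < q) (hF : χ.FactorsThrough d) : ¬ χ.IsPrimitive := by
  intro hprim
  have hdpos : 0 < d := Nat.pos_of_ne_zero fun h0 => by
    subst h0; exact (NeZero.ne q) (zero_dvd_iff.mp hd)
  have hcond : χ.conductor ∣ d :=
    (mem_conductorSet_iff_conductor_dvd χ hd).mp ((mem_conductorSet_iff χ).mpr hF)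
  rw [hprim] at hcond
  exact absurd (Nat.le_of_dvd hdpos hcond) (not_le.mpr hdq)

/-- The level of a primitive quadratic character is not divisible by the square of an odd
prime. [folklore] -/
theorem not_odd_prime_sq_dvd (χ : DirichletCharacter R q) (hprim : χ.IsPrimitive)
    (hχ : χ.IsQuadratic) {p : ℕ} (hp : p.Prime) (hp2 : p ≠ 2) : ¬ p ^ 2 ∣ q := by
  intro hpq
  have hpq1 : p ∣ q := (dvd_pow_self p two_ne_zero).trans hpq
  exact not_isPrimitive_of_factorsThrough χ (Nat.div_dvd_of_dvd hpq1)
    (Nat.div_lt_self (NeZero.pos q) hp.one_lt)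
    (factorsThrough_div_of_odd_prime_sq_dvd χ hχ hp hp2 hpq) hprim

/-- The level of a primitive quadratic character is not divisible by `16`. [folklore] -/
theorem not_sixteen_dvd (χ : DirichletCharacter R q) (hprim : χ.IsPrimitive)
    (hχ : χ.IsQuadratic) : ¬ 16 ∣ q := by
  intro h16
  have h2q : 2 ∣ q := (by norm_num : (2 : ℕ) ∣ 16).trans h16
  exact not_isPrimitive_of_factorsThrough χ (Nat.div_dvd_of_dvd h2q)
    (Nat.div_lt_self (NeZero.pos q) one_lt_two)
    (factorsThrough_div_two_of_sixteen_dvd χ hχ h16) hprim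

/-- For a primitive quadratic character mod `q = 2^r q'` (`q'` odd), `q'` is squarefree ("note
that `q'` is necessarily square-free (see e.g. [IwKo])").
[cite: MatomakiMerikoski2023, remark after Theorem 1.3] -/
theorem squarefree_oddPart (χ : DirichletCharacter R q) (hprim : χ.IsPrimitive)
    (hχ : χ.IsQuadratic) : Squarefree (q / 2 ^ padicValNat 2 q) := by
  rw [← Nat.factorization_def q Nat.prime_two, Nat.squarefree_iff_prime_squarefree]
  intro p hp hpp
  have hdvd : p * p ∣ q := hpp.trans (Nat.ordCompl_dvd q 2)
  by_cases hp2 : p = 2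
  · subst hp2
    exact Nat.not_dvd_ordCompl Nat.prime_two (NeZero.ne q) ((dvd_mul_right 2 2).trans hpp)
  · exact not_odd_prime_sq_dvd χ hprim hχ hp hp2 (by rw [pow_two]; exact hdvd)

/-- For a primitive quadratic character mod `q = 2^r q'` (`q'` odd), `r ≤ 3`, so `q ≤ 8 q'`.
[folklore] -/
theorem le_eight_mul_oddPart (χ : DirichletCharacter R q) (hprim : χ.IsPrimitive)
    (hχ : χ.IsQuadratic) : q ≤ 8 * (q / 2 ^ padicValNat 2 q) := by
  have hr : padicValNat 2 q ≤ 3 := by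
    by_contra hlt
    push Not at hlt
    have : 2 ^ 4 ∣ q := (pow_dvd_pow 2 hlt).trans pow_padicValNat_dvd
    exact not_sixteen_dvd χ hprim hχ (by norm_num at this ⊢; exact this)
  have hq : 2 ^ padicValNat 2 q * (q / 2 ^ padicValNat 2 q) = q :=
    Nat.mul_div_cancel' pow_padicValNat_dvd
  calc q = 2 ^ padicValNat 2 q * (q / 2 ^ padicValNat 2 q) := hq.symm
    _ ≤ 2 ^ 3 * (q / 2 ^ padicValNat 2 q) :=
        Nat.mul_le_mul_right _ (Nat.pow_le_pow_right two_pos hr)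
    _ = 8 * (q / 2 ^ padicValNat 2 q) := by norm_num

/-- The odd part `q' = q / 2^r` is odd. [folklore] -/
theorem two_not_dvd_oddPart (q : ℕ) [NeZero q] : ¬ 2 ∣ q / 2 ^ padicValNat 2 q := by
  rw [← Nat.factorization_def q Nat.prime_two]
  exact Nat.not_dvd_ordCompl Nat.prime_two (NeZero.ne q)

/-- For a finset of primes `≥ 5`: `∏ p ≤ (∏ (p − 2))²` (termwise `p ≤ (p − 2)²`). [folklore] -/
theorem prod_le_sq_prod_sub_two {P : Finset ℕ} (hP : ∀ p ∈ P, 5 ≤ p) :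
    (∏ p ∈ P, (p : ℝ)) ≤ (∏ p ∈ P, ((p : ℝ) - 2)) ^ 2 := by
  rw [← Finset.prod_pow]
  refine Finset.prod_le_prod (fun p _ => by positivity) fun p hp => ?_
  have h5 : (5 : ℝ) ≤ p := by exact_mod_cast hP p hp
  nlinarith

/-- For a finset of odd primes: `∏ p ≤ 3 (∏ (p − 2))²` (only `p = 3` loses). [folklore] -/
theorem prod_le_three_mul_sq_prod_sub_two {P : Finset ℕ} (hP : ∀ p ∈ P, p.Prime ∧ p ≠ 2) :
    (∏ p ∈ P, (p : ℝ)) ≤ 3 * (∏ p ∈ P, ((p : ℝ) - 2)) ^ 2 := by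
  rw [← Finset.prod_filter_mul_prod_filter_not P (fun p => p = 3) (fun p => (p : ℝ)),
    ← Finset.prod_filter_mul_prod_filter_not P (fun p => p = 3) (fun p => ((p : ℝ) - 2))]
  have hA : ∏ p ∈ P.filter (fun p => p = 3), (p : ℝ) ≤ 3 := by
    rw [Finset.filter_eq']
    split_ifs
    · rw [Finset.prod_singleton]; norm_num
    · rw [Finset.prod_empty]; norm_num
  have hB : ∏ p ∈ P.filter (fun p => p = 3), ((p : ℝ) - 2) = 1 :=
    Finset.prod_eq_one fun p hp => by rw [(Finset.mem_filter.mp hp).2]; norm_num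
  have hC : ∏ p ∈ P.filter (fun p => ¬ p = 3), (p : ℝ) ≤
      (∏ p ∈ P.filter (fun p => ¬ p = 3), ((p : ℝ) - 2)) ^ 2 := by
    refine prod_le_sq_prod_sub_two fun p hp => ?_
    obtain ⟨hpP, hp3⟩ := Finset.mem_filter.mp hp
    exact (hP p hpP).1.five_le_of_ne_two_of_ne_three (hP p hpP).2 hp3
  have hCpos : 0 ≤ ∏ p ∈ P.filter (fun p => ¬ p = 3), (p : ℝ) :=
    Finset.prod_nonneg fun p _ => by positivity
  rw [hB, one_mul]
  calc (∏ p ∈ P.filter (fun p => p = 3), (p : ℝ)) * ∏ p ∈ P.filter (fun p => ¬ p = 3), (p : ℝ)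
      ≤ 3 * ∏ p ∈ P.filter (fun p => ¬ p = 3), (p : ℝ) := mul_le_mul_of_nonneg_right hA hCpos
    _ ≤ 3 * (∏ p ∈ P.filter (fun p => ¬ p = 3), ((p : ℝ) - 2)) ^ 2 := by gcongr

/-- **Size of the level against the correction product.** For `χ` primitive quadratic mod
`q = 2^r q'` and `h ≥ 1`: `q ≤ 24 h (∏_{p ∣ q', p ∤ h} (p − 2))²` (`q ≤ 8q'`, `q'` squarefree so
`q' = ∏_{p ∣ q'} p ≤ h ∏_{p ∣ q', p ∤ h} p`, and `∏ p ≤ 3 (∏ (p − 2))²` over odd primes).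
[folklore] -/
theorem level_le_mul_sq_corrProd (χ : DirichletCharacter R q) (hprim : χ.IsPrimitive)
    (hχ : χ.IsQuadratic) {h : ℕ} (hh : 1 ≤ h) :
    (q : ℝ) ≤ 24 * h *
      (∏ p ∈ (q / 2 ^ padicValNat 2 q).primeFactors.filter (fun p => ¬ p ∣ h),
        ((p : ℝ) - 2)) ^ 2 := by
  set q' := q / 2 ^ padicValNat 2 q with hq'
  have hsq : Squarefree q' := squarefree_oddPart χ hprim hχ
  have h8 : q ≤ 8 * q' := le_eight_mul_oddPart χ hprim hχ
  have hodd : ¬ 2 ∣ q' := two_not_dvd_oddPart q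
  have hprod : ∏ p ∈ q'.primeFactors, p = q' := Nat.prod_primeFactors_of_squarefree hsq
  have hsplit := Finset.prod_filter_mul_prod_filter_not q'.primeFactors (fun p => p ∣ h)
    (fun p => p)
  have hQ : ∏ p ∈ q'.primeFactors.filter (fun p => p ∣ h), p ∣ h :=
    Finset.prod_primes_dvd h
      (fun p hp => (Nat.prime_of_mem_primeFactors (Finset.mem_filter.mp hp).1).prime)
      (fun p hp => (Finset.mem_filter.mp hp).2)
  have hQle : ∏ p ∈ q'.primeFactors.filter (fun p => p ∣ h), p ≤ h := Nat.le_of_dvd hh hQ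
  have hq'le : q' ≤ h * ∏ p ∈ q'.primeFactors.filter (fun p => ¬ p ∣ h), p := by
    calc q' = (∏ p ∈ q'.primeFactors.filter (fun p => p ∣ h), p) *
          ∏ p ∈ q'.primeFactors.filter (fun p => ¬ p ∣ h), p := by rw [hsplit, hprod]
      _ ≤ h * ∏ p ∈ q'.primeFactors.filter (fun p => ¬ p ∣ h), p :=
          Nat.mul_le_mul_right _ hQle
  have hP : ∀ p ∈ q'.primeFactors.filter (fun p => ¬ p ∣ h), p.Prime ∧ p ≠ 2 := by
    intro p hp
    have hp' := (Finset.mem_filter.mp hp).1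
    refine ⟨Nat.prime_of_mem_primeFactors hp', fun h2 => hodd ?_⟩
    subst h2
    exact Nat.dvd_of_mem_primeFactors hp'
  have hR := prod_le_three_mul_sq_prod_sub_two hP
  have h1 : (q : ℝ) ≤ 8 * q' := by exact_mod_cast h8
  have h2 : (q' : ℝ) ≤ h * ∏ p ∈ q'.primeFactors.filter (fun p => ¬ p ∣ h), (p : ℝ) := by
    have := Nat.cast_le (α := ℝ).mpr hq'le
    push_cast at this
    exact this
  calc (q : ℝ) ≤ 8 * q' := h1
    _ ≤ 8 * (h * ∏ p ∈ q'.primeFactors.filter (fun p => ¬ p ∣ h), (p : ℝ)) := by gcongr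
    _ ≤ 8 * (h * (3 * (∏ p ∈ q'.primeFactors.filter (fun p => ¬ p ∣ h), ((p : ℝ) - 2)) ^ 2)) := by
        gcongr
    _ = 24 * h * (∏ p ∈ q'.primeFactors.filter (fun p => ¬ p ∣ h), ((p : ℝ) - 2)) ^ 2 := by
        ring

/-- The Matomäki–Merikoski correction factor is at most `√(24 h / q)` in absolute value for a
primitive quadratic character mod `q` and `h ≥ 1`. [folklore] -/
theorem abs_corr_le (χ : DirichletCharacter R q) (hprim : χ.IsPrimitive) (hχ : χ.IsQuadratic)
    {h : ℕ} (hh : 1 ≤ h) :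
    |(if Nat.totient (2 ^ padicValNat 2 q) ∣ h then
        (-1 : ℝ) ^ (h / Nat.totient (2 ^ padicValNat 2 q)) *
          ∏ p ∈ (q / 2 ^ padicValNat 2 q).primeFactors.filter (fun p => ¬ p ∣ h),
            (-1 : ℝ) / ((p : ℝ) - 2)
      else 0)| ≤ Real.sqrt (24 * h / q) := by
  split_ifs with hdiv
  · set P := (q / 2 ^ padicValNat 2 q).primeFactors.filter (fun p => ¬ p ∣ h) with hPdef
    have hodd : ¬ 2 ∣ q / 2 ^ padicValNat 2 q := two_not_dvd_oddPart q
    have hP3 : ∀ p ∈ P, (3 : ℝ) ≤ p := by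
      intro p hp
      have hp' := (Finset.mem_filter.mp hp).1
      have hpr := Nat.prime_of_mem_primeFactors hp'
      have hp2 : p ≠ 2 := by
        rintro rfl
        exact hodd (Nat.dvd_of_mem_primeFactors hp')
      exact_mod_cast lt_of_le_of_ne hpr.two_le (Ne.symm hp2)
    have hPIpos : 0 < ∏ p ∈ P, ((p : ℝ) - 2) :=
      Finset.prod_pos fun p hp => by linarith [hP3 p hp]
    have habs : |(-1 : ℝ) ^ (h / Nat.totient (2 ^ padicValNat 2 q)) *
        ∏ p ∈ P, (-1 : ℝ) / ((p : ℝ) - 2)| = (∏ p ∈ P, ((p : ℝ) - 2))⁻¹ := by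
      rw [abs_mul, abs_pow, abs_neg, abs_one, one_pow, one_mul, Finset.abs_prod,
        ← Finset.prod_inv_distrib]
      refine Finset.prod_congr rfl fun p hp => ?_
      rw [abs_div, abs_neg, abs_one, abs_of_pos (by linarith [hP3 p hp]), one_div]
    rw [habs]
    have hq0 : (0 : ℝ) < q := by exact_mod_cast NeZero.pos q
    have hlevel := level_le_mul_sq_corrProd χ hprim hχ hh
    refine Real.le_sqrt_of_sq_le ?_
    rw [inv_pow, inv_le_comm₀ (by positivity) (by positivity), inv_div,
      div_le_iff₀ (by positivity)]
    linarith [hlevel]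
  · rw [abs_zero]; exact Real.sqrt_nonneg _

end Literature.Barriers.Parity.SiegelCorr

/-! ### Corollary 1.1(ii) from Theorem 1.3 -/

open Finset Real
open scoped ArithmeticFunction.vonMangoldt

namespace Literature.Barriers.Parity

/-- **Matomäki–Merikoski 2023, Corollary 1.1(ii) from Theorem 1.3** (the printed deduction,
p. 4: "Corollaries 1.1(i) and 1.2 immediately follow from Theorems 1.3 and 1.4 since by Siegel's
theorem `η ≪_ε q^ε`. For `X ≥ q^{10 log η}` the quantity
`1/η = exp(−log η) ≫ exp(−√((log q)(log η))) ≫ exp(−√log X)` dominates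
`exp(−C(log X)^{3/5−ε})` and `exp(−C V √log η)`, so also Corollary 1.1(ii) follows from
Theorem 1.3"). Siegel's theorem is the tree's `Literature.NumberTheory.LFunctions.Siegel.exists_one_sub_realZero_ge`
(Montgomery–Vaughan Cor. 11.15, used with exponent `1/4`: `η ≤ q^{1/4}/(C log 2)`); the
correction factor of Theorem 1.3 is `≤ √(24h/q) ≤ √(24h) D²/η` for a fixed shift `h`
(`SiegelCorr.abs_corr_le`, using that the odd part of the conductor of a primitive quadratic
character is squarefree and its `2`-part divides `8`).
[cite: MatomakiMerikoski2023, Corollary 1.1(ii) and its proof after Theorem 1.4] -/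
theorem MatomakiMerikoski2023_fixedShift_ii_of_pairCorrelation
    (h13 : MatomakiMerikoski2023_pairCorrelation) : MatomakiMerikoski2023_fixedShift_ii := by
  intro h hh ε hε
  -- Siegel's theorem (MV Cor. 11.15) with exponent `1/4`
  obtain ⟨CS, hCS, hSiegel⟩ := Literature.NumberTheory.LFunctions.Siegel.exists_one_sub_realZero_ge (ε := 1 / 4) (by norm_num)
  have hlog2 : 0 < Real.log 2 := Real.log_pos one_lt_two
  set D : ℝ := 1 / (CS * Real.log 2) with hDdef
  have hD : 0 < D := by positivity
  -- Theorem 1.3 with `C = 1`, `ε = 1/10`, `A = h`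
  have hh0 : (0 : ℝ) < h := by exact_mod_cast hh
  obtain ⟨K₁, hK₁, h13'⟩ := h13 1 le_rfl (1 / 10) (by norm_num) h hh0
  have htot : (0 : ℝ) < (Nat.totient h : ℝ) := by exact_mod_cast Nat.totient_pos.mpr hh
  set G : ℝ := Literature.NumberTheory.Sieve.goldbachSingularSeries h with hGdef
  refine ⟨K₁ * ((h : ℝ) / (Nat.totient h : ℝ)) * (3 + D ^ 2) + |G| * Real.sqrt (24 * h) * D ^ 2,
    by positivity, ?_⟩
  intro q _ hq χ hprim hquad η hη hzero V X hVlo hVhi hX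
  -- basic positivity
  have hq2 : (2 : ℝ) ≤ q := by exact_mod_cast hq
  have hq1 : (1 : ℝ) ≤ q := by linarith
  have hq0 : (0 : ℝ) < q := by linarith
  have hlogq : Real.log 2 ≤ Real.log q := Real.log_le_log two_pos hq2
  have hlogq0 : 0 < Real.log q := lt_of_lt_of_le hlog2 hlogq
  have hη0 : (0 : ℝ) < η := by linarith
  have hη1 : (1 : ℝ) ≤ η := by linarith
  set L : ℝ := Real.log η with hLdef
  have hL1 : 1 ≤ L := by
    rw [hLdef, Real.le_log_iff_exp_le hη0]
    linarith [Real.exp_one_lt_three]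
  have hL0 : 0 < L := by linarith
  have hV10 : 10 ≤ V := by
    have : (10 : ℝ) * 1 ≤ 10 * L := mul_le_mul_of_nonneg_left hL1 (by norm_num)
    linarith
  have hV0 : 0 < V := by linarith
  have hLV : L ≤ V := by linarith
  have hX1 : 1 ≤ X := by rw [hX]; exact Real.one_le_rpow hq1 hV0.le
  have hX0 : 0 < X := by linarith
  have hlogX : Real.log X = V * Real.log q := by rw [hX, Real.log_rpow hq0]
  -- `χ ≠ 1`, `χ² = 1`
  have hne : χ ≠ 1 := by
    intro h1
    have := (DirichletCharacter.eq_one_iff_conductor_eq_one (χ := χ)).mp h1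
    rw [hprim] at this
    omega
  -- Siegel: `η ≤ D q^{1/4}`
  have hηD : η ≤ D * (q : ℝ) ^ (1 / 4 : ℝ) := by
    have hS := hSiegel q χ hquad.sq_eq_one hne (1 - 1 / (η * Real.log q)) hzero
    have hS' : CS * (q : ℝ) ^ (-(1 / 4 : ℝ)) ≤ 1 / (η * Real.log q) := by linarith
    have hpos : 0 < CS * (q : ℝ) ^ (-(1 / 4 : ℝ)) := by positivity
    have hηlog : η * Real.log q ≤ (q : ℝ) ^ (1 / 4 : ℝ) / CS := by
      have := (le_one_div hpos (by positivity)).mp hS'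
      -- `this : η * log q ≤ 1 / (CS * q^{-1/4})`
      calc η * Real.log q ≤ 1 / (CS * (q : ℝ) ^ (-(1 / 4 : ℝ))) := this
        _ = (q : ℝ) ^ (1 / 4 : ℝ) / CS := by
            rw [Real.rpow_neg hq0.le]; field_simp
    have hq14 : 0 < (q : ℝ) ^ (1 / 4 : ℝ) := Real.rpow_pos_of_pos hq0 _
    calc η = η * Real.log q / Real.log q := by field_simp
      _ ≤ ((q : ℝ) ^ (1 / 4 : ℝ) / CS) / Real.log q := by gcongr
      _ ≤ ((q : ℝ) ^ (1 / 4 : ℝ) / CS) / Real.log 2 := by gcongr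
      _ = D * (q : ℝ) ^ (1 / 4 : ℝ) := by rw [hDdef]; field_simp
  -- consequence: `1/√q ≤ D²/η`
  have hsqrtq : 1 / Real.sqrt q ≤ D ^ 2 / η := by
    have hq14sq : ((q : ℝ) ^ (1 / 4 : ℝ)) ^ 2 = Real.sqrt q := by
      rw [← Real.rpow_natCast, ← Real.rpow_mul hq0.le, Real.sqrt_eq_rpow]; norm_num
    have hη2 : η ^ 2 ≤ D ^ 2 * Real.sqrt q := by
      calc η ^ 2 ≤ (D * (q : ℝ) ^ (1 / 4 : ℝ)) ^ 2 := pow_le_pow_left₀ hη0.le hηD 2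
        _ = D ^ 2 * Real.sqrt q := by rw [mul_pow, hq14sq]
    rw [div_le_div_iff₀ (Real.sqrt_pos.mpr hq0) hη0, one_mul]
    exact (le_self_pow₀ hη1 two_ne_zero).trans hη2
  -- the target error `T = log⁶η / (η/V)` dominates `1/η`
  set T : ℝ := L ^ 6 / (η / V) with hTdef
  have hT' : T = V * L ^ 6 / η := by rw [hTdef, div_div_eq_mul_div]; ring
  have hTη : 1 / η ≤ T := by
    rw [hT']
    refine div_le_div_of_nonneg_right ?_ hη0.le
    have hL6 : 1 ≤ L ^ 6 := one_le_pow₀ hL1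
    exact one_le_mul_of_one_le_of_one_le (by linarith) hL6
  have hT0 : 0 < T := lt_of_lt_of_le (by positivity) hTη
  -- E1 = exp(−√(V log η)) ≤ 1/η
  have hE1 : Real.exp (-1 * Real.sqrt (V * L)) ≤ 1 / η := by
    rw [neg_one_mul, Real.exp_neg, one_div, inv_le_inv₀ (Real.exp_pos _) hη0]
    calc η = Real.exp L := (Real.exp_log hη0).symm
      _ ≤ Real.exp (Real.sqrt (V * L)) := Real.exp_le_exp.mpr ?_
    calc L = Real.sqrt (L ^ 2) := (Real.sqrt_sq hL0.le).symm
      _ ≤ Real.sqrt (V * L) :=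
          Real.sqrt_le_sqrt (by rw [pow_two]; exact mul_le_mul_of_nonneg_right hLV hL0.le)
  -- E2 = exp(−(log X)^{1/2}) ≤ (1 + D²)/η
  have hE2 : Real.exp (-1 * Real.log X ^ (3 / 5 - 1 / 10 : ℝ)) ≤ (1 + D ^ 2) / η := by
    have hexp : (3 / 5 - 1 / 10 : ℝ) = 1 / 2 := by norm_num
    rw [hexp, ← Real.sqrt_eq_rpow, neg_one_mul, hlogX]
    rcases le_or_gt η q with hle | hlt
    · have hlq : L ≤ Real.log q := Real.log_le_log hη0 hle
      have h1 : Real.exp (-Real.sqrt (V * Real.log q)) ≤ 1 / η := by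
        rw [Real.exp_neg, one_div, inv_le_inv₀ (Real.exp_pos _) hη0]
        calc η = Real.exp L := (Real.exp_log hη0).symm
          _ ≤ Real.exp (Real.sqrt (V * Real.log q)) := Real.exp_le_exp.mpr ?_
        calc L = Real.sqrt (L ^ 2) := (Real.sqrt_sq hL0.le).symm
          _ ≤ Real.sqrt (V * Real.log q) :=
              Real.sqrt_le_sqrt (by rw [pow_two]; exact mul_le_mul hLV hlq hL0.le hV0.le)
      calc Real.exp (-Real.sqrt (V * Real.log q)) ≤ 1 / η := h1
        _ ≤ (1 + D ^ 2) / η :=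
            div_le_div_of_nonneg_right (le_add_of_nonneg_right (sq_nonneg D)) hη0.le
    · -- `q < η`: then `η ≤ D q^{1/4} ≤ D √q ≤ D √η`, so `η ≤ D²`
      have hchain : η ≤ D * Real.sqrt η := by
        calc η ≤ D * (q : ℝ) ^ (1 / 4 : ℝ) := hηD
          _ ≤ D * (q : ℝ) ^ (1 / 2 : ℝ) :=
              mul_le_mul_of_nonneg_left
                (Real.rpow_le_rpow_of_exponent_le hq1 (by norm_num : (1 / 4 : ℝ) ≤ 1 / 2)) hD.le
          _ = D * Real.sqrt q := by rw [Real.sqrt_eq_rpow]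
          _ ≤ D * Real.sqrt η := by gcongr
      have hs0 : 0 < Real.sqrt η := Real.sqrt_pos.mpr hη0
      have hsD : Real.sqrt η ≤ D := by
        calc Real.sqrt η = η / Real.sqrt η := Real.div_sqrt.symm
          _ ≤ D * Real.sqrt η / Real.sqrt η := by gcongr
          _ = D := by field_simp
      have hηD2 : η ≤ D ^ 2 := by
        calc η = Real.sqrt η ^ 2 := (Real.sq_sqrt hη0.le).symm
          _ ≤ D ^ 2 := pow_le_pow_left₀ hs0.le hsD 2
      have h1 : Real.exp (-Real.sqrt (V * Real.log q)) ≤ 1 := by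
        rw [Real.exp_le_one_iff]
        linarith [Real.sqrt_nonneg (V * Real.log q)]
      calc Real.exp (-Real.sqrt (V * Real.log q)) ≤ 1 := h1
        _ ≤ (1 + D ^ 2) / η := by rw [le_div_iff₀ hη0]; linarith
  have hE2' : (1 + D ^ 2) / η ≤ (1 + D ^ 2) * T := by
    rw [div_eq_mul_one_div]
    exact mul_le_mul_of_nonneg_left hTη (by positivity)
  -- the correction factor
  have hcorr := SiegelCorr.abs_corr_le (R := ℂ) χ hprim hquad hh
  have hcorr' : Real.sqrt (24 * h / q) ≤ Real.sqrt (24 * h) * D ^ 2 / η := by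
    rw [Real.sqrt_div' _ hq0.le]
    calc Real.sqrt (24 * h) / Real.sqrt q = Real.sqrt (24 * h) * (1 / Real.sqrt q) := by ring
      _ ≤ Real.sqrt (24 * h) * (D ^ 2 / η) := by gcongr
      _ = Real.sqrt (24 * h) * D ^ 2 / η := by ring
  have hcorrT : Real.sqrt (24 * h) * D ^ 2 / η ≤ Real.sqrt (24 * h) * D ^ 2 * T := by
    rw [div_eq_mul_one_div]
    exact mul_le_mul_of_nonneg_left hTη (by positivity)
  -- Theorem 1.3
  have hhX : (h : ℝ) ≤ h * X := le_mul_of_one_le_right hh0.le hX1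
  have hmain := h13' q hq χ hprim hquad η hη hzero V X hV10 hX h hh hhX
  -- assemble
  set S : ℝ := ∑ n ∈ Icc 1 ⌊X⌋₊, Λ n * Λ (n + h) with hSdef
  set corr : ℝ := (if Nat.totient (2 ^ padicValNat 2 q) ∣ h then
        (-1 : ℝ) ^ (h / Nat.totient (2 ^ padicValNat 2 q)) *
          ∏ p ∈ (q / 2 ^ padicValNat 2 q).primeFactors.filter (fun p => ¬ p ∣ h),
            (-1 : ℝ) / ((p : ℝ) - 2)
      else 0) with hcorrdef
  have htri : |S - X * G| ≤ |S - X * G * (1 + corr)| + |X * G * (1 + corr) - X * G| :=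
    abs_sub_le _ _ _
  have hmid : |X * G * (1 + corr) - X * G| = X * |G| * |corr| := by
    rw [show X * G * (1 + corr) - X * G = X * G * corr by ring, abs_mul, abs_mul, abs_of_pos hX0]
  have hsum : Real.exp (-1 * Real.sqrt (V * L)) + Real.exp (-1 * Real.log X ^ (3 / 5 - 1 / 10 : ℝ))
      + V * L ^ 6 / η ≤ (3 + D ^ 2) * T := by
    rw [← hT']
    linarith
  have hc0 : 0 ≤ K₁ * ((h : ℝ) / (Nat.totient h : ℝ)) * X := by positivity
  calc |S - X * G| ≤ |S - X * G * (1 + corr)| + |X * G * (1 + corr) - X * G| := htri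
    _ ≤ K₁ * ((h : ℝ) / (Nat.totient h : ℝ)) * X *
          (Real.exp (-1 * Real.sqrt (V * L)) + Real.exp (-1 * Real.log X ^ (3 / 5 - 1 / 10 : ℝ))
            + V * L ^ 6 / η) + X * |G| * |corr| := by
        rw [hmid]; exact add_le_add hmain le_rfl
    _ ≤ K₁ * ((h : ℝ) / (Nat.totient h : ℝ)) * X * ((3 + D ^ 2) * T) +
          X * |G| * (Real.sqrt (24 * h) * D ^ 2 * T) := by
        gcongr
        · exact (hcorr.trans hcorr').trans hcorrT
    _ = (K₁ * ((h : ℝ) / (Nat.totient h : ℝ)) * (3 + D ^ 2) + |G| * Real.sqrt (24 * h) * D ^ 2)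
          * X * T := by ring
    _ = _ := by rw [hTdef]

end Literature.Barriers.Parity

end
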